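import Summits.NavierStokesRegularity.NavierStokesRegularity.Theorems.ScalingDefectPeepholeDoorSerrinBackward
import Summits.NavierStokesRegularity.NavierStokesRegularity.Theorems.ScalingDefectPeepholeDoorSerrinTypeI
import Literature.Analysis.FluidPDE.ConstantinFeffermanEnstrophySlab
import HarnessLib

/-!
# ArgmaxNearDoorsTypeICore — door family S36 (nsreg-p1 ROUND-34/35, seed τ2 «TYPE-I ⇒ (G)»):
# parabolic smoothing of the vorticity gradient under a Type-I velocity bound

S-door lane (ns-sfl-p1 g5; KEY by LEAD ns-s30-p1 g3 2026-08-28T17:49:54Z; `--supports stmt-NavierStokesRegularity-0056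
--as helper`; text-independent — the door variant is typed by nsreg-p1 g31 in ROUND-35). Door S36-C𝔞 «ArgmaxAnnulusDoor»
charges, besides the annulus depletion, the PARABOLIC-CORE LIPSCHITZ bound
(G) `‖ω(y,t) − ω(x̄,t)‖ ≤ Γ‖ω(x̄,t)‖/√(ν(T−t)) · ‖y − x̄‖`. This file proves that (G) is AUTOMATIC under a Type-I
velocity bound, with `Γ = 8κK/ε` at every critical argmax (`ε < (T−t)‖ω(x̄,t)‖`, `κ = ‖curlCLM‖`):

* `exists_norm_iteratedFDeriv_two_le_of_typeI` — ∃ `K = K(M) ≥ 0`: for every classical unforced solution on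
  `[0,T) × ℝ³` (`ν > 0`) with the scale-invariant Type-I bound `‖u(s,y)‖ ≤ M√ν/√(T−s)` on `[t₀,T)`, every `t` with
  `t₀ ≤ t − (T−t)/4` and every `x`: `‖D²u(t,·)(x)‖ ≤ 8K/(√ν·(T−t)·√(T−t))`. Proof: the parabolic zoom
  `w(s,y) = (c/ν)·u(t + (T−t)/8 + (c²/ν)s, x + cy)`, `c = √(ν(T−t))/2`, is a classical `ν = 1` solution on the unit
  backward cylinder with `|w| ≤ M` (`IsClassicalNSSolutionOnRegion.stRescale_of_isOpen`); Serrin's pressure-free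
  bound `Serrin.norm_iteratedFDeriv_le_of_classical_backward` (order 2, radius 3/4) at the interior point `(−1/2, 0)`
  (our `(t,x)`); undo the zoom (`Serrin.norm_iteratedFDeriv_comp_smul_le'`).
* `norm_fderiv_curl_le_of_typeI` — hence `‖D ω(t,·)(y)‖ ≤ 8κK/(√ν·(T−t)·√(T−t))` everywhere;
* `typeI_core_lipschitz` — and at a critical argmax `x̄`: `‖ω(y) − ω(x̄)‖ ≤ (8κK/ε)·‖ω(x̄)‖/√(ν(T−t))·‖y − x̄‖`
  for ALL `y` (mean value inequality) — hypothesis (G) of `ArgmaxAnnulusDoor` with `Γ = 8κK/ε`, any `θ`.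

WHAT THIS IS NOT: a smoothing lemma about HYPOTHETICAL Type-I blow-up serving a regularity CRITERION (door S36-C𝔞);
item 0056 `NoTypeII` and NS regularity are NOT proved; nothing here is a route or a summit statement.
-/

-- the summit's problem namespace repeats the summit name (tree layout)
set_option linter.dupNamespace false

noncomputable section

open MeasureTheory Set Function Filter Topology Metric InnerProductSpace
open scoped NNReal ENNReal RealInnerProductSpace ContDiff
open Literature.Analysis Literature.Analysis.FluidPDE

namespace Summit.NavierStokesRegularity.NavierStokesRegularity.Theorems.ArgmaxDoors

open Summit.NavierStokesRegularity.NavierStokesRegularity.Theorems.ScalingDefectPeepholeDoor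

/-! ### The Hessian of the velocity under a Type-I bound -/

set_option maxHeartbeats 400000 in
/-- **Parabolic smoothing under a Type-I velocity bound (pressure-free, Serrin).** There is `K = K(M) ≥ 0` such that:
for every classical unforced Navier–Stokes solution on `[0,T) × ℝ³` (`ν > 0`), every `t₀ ≥ 0` with the
scale-invariant Type-I bound `‖u(s,y)‖ ≤ M·√ν/√(T−s)` for `s ∈ [t₀,T)`, every `t ∈ [t₀,T)` with
`t₀ ≤ t − (T−t)/4`, and every `x`: `‖D²u(t,·)(x)‖ ≤ 8K/(√ν·(T−t)·√(T−t))`. -/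
theorem exists_norm_iteratedFDeriv_two_le_of_typeI (M : ℝ) : ∃ K : ℝ, 0 ≤ K ∧
    ∀ (ν T t₀ : ℝ) (u : ℝ → EuclideanSpace ℝ (Fin 3) → EuclideanSpace ℝ (Fin 3))
      (p : ℝ → EuclideanSpace ℝ (Fin 3) → ℝ), 0 < ν →
      IsClassicalNSSolutionOn (Ico 0 T) ν 0 u p → 0 ≤ t₀ →
      (∀ s ∈ Ico t₀ T, ∀ y, ‖u s y‖ ≤ M * Real.sqrt ν / Real.sqrt (T - s)) →
      ∀ t ∈ Ico t₀ T, t₀ ≤ t - (T - t) / 4 → ∀ x,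
        ‖iteratedFDeriv ℝ 2 (u t) x‖ ≤ 8 * K / (Real.sqrt ν * (T - t) * Real.sqrt (T - t)) := by
  obtain ⟨K, hK0, hK⟩ := Serrin.norm_iteratedFDeriv_le_of_classical_backward 2 (r := 3 / 4)
    (by norm_num) (by norm_num) M
  refine ⟨K, hK0, fun ν T t₀ u p hν hsol ht₀ hTI t ht ht4 x => ?_⟩
  have hTt : 0 < T - t := sub_pos.2 ht.2
  have hsν : 0 < Real.sqrt ν := Real.sqrt_pos.2 hν
  have hsT : 0 < Real.sqrt (T - t) := Real.sqrt_pos.2 hTt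
  -- `M ≥ 0` from the bound at `(t, x)`
  have hM : 0 ≤ M := by
    have h := hTI t ht x
    by_contra hneg
    have : M * Real.sqrt ν / Real.sqrt (T - t) < 0 :=
      div_neg_of_neg_of_pos (mul_neg_of_neg_of_pos (not_le.1 hneg) hsν) hsT
    exact ((norm_nonneg _).trans h).not_gt this
  -- the zoom scale `c = √(ν(T−t))/2` and the top time `t + (T−t)/8` (opaque names, no `set`)
  obtain ⟨c, hc⟩ : ∃ c : ℝ, c = Real.sqrt ν * Real.sqrt (T - t) / 2 := ⟨_, rfl⟩
  have hc0 : 0 < c := by rw [hc]; positivity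
  have hc2 : c ^ 2 = ν * (T - t) / 4 := by
    rw [hc, div_pow, mul_pow, Real.sq_sqrt hν.le, Real.sq_sqrt hTt.le]; ring
  obtain ⟨tt, htt⟩ : ∃ tt : ℝ, tt = t + (T - t) / 8 := ⟨_, rfl⟩
  have hcs : c ^ 2 / ν = (T - t) / 4 := by rw [hc2]; field_simp
  -- the open region of smoothness and the rescaled solution (`ν ↦ 1`)
  have hΩo : IsOpen (Ioo 0 T ×ˢ (univ : Set (EuclideanSpace ℝ (Fin 3)))) := isOpen_Ioo.prod isOpen_univ
  have hclΩ : IsClassicalNSSolutionOnRegion (Ioo 0 T ×ˢ (univ : Set (EuclideanSpace ℝ (Fin 3)))) ν 0 u p :=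
    hsol.onRegion.mono_of_isOpen (prod_mono Ioo_subset_Ico_self subset_rfl) hΩo
  have hβ : c ^ 2 / ν = c / ν * c := by field_simp
  have hresc := hclΩ.stRescale_of_isOpen hΩo (α := c / ν) (β := c ^ 2 / ν) (γ := c) (by positivity) hc0
    hβ tt x
  have e0 : (((c / ν) ^ 2 * c) • stPull (c ^ 2 / ν) c tt x
      (0 : ℝ → EuclideanSpace ℝ (Fin 3) → EuclideanSpace ℝ (Fin 3))) = 0 := by
    funext s y; simp [stPull]
  have eν : c / ν * ν / c = 1 := by field_simp
  rw [e0, eν] at hresc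
  obtain ⟨w, hw⟩ : ∃ w : ℝ → EuclideanSpace ℝ (Fin 3) → EuclideanSpace ℝ (Fin 3),
      w = (c / ν) • stPull (c ^ 2 / ν) c tt x u := ⟨_, rfl⟩
  obtain ⟨π, hπ⟩ : ∃ π : ℝ → EuclideanSpace ℝ (Fin 3) → ℝ, π = (c / ν) ^ 2 • stPull (c ^ 2 / ν) c tt x p :=
    ⟨_, rfl⟩
  rw [← hw, ← hπ] at hresc
  -- times of the unit backward cylinder land in `(t − (T−t)/8, t + (T−t)/8) ⊂ (t₀, T)`
  have htime : ∀ s ∈ Ioo (-1 : ℝ) 0,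
      t - (T - t) / 8 < tt + c ^ 2 / ν * s ∧ tt + c ^ 2 / ν * s < t + (T - t) / 8 := by
    intro s hs
    rw [hcs, htt]
    constructor
    · nlinarith [hs.1]
    · nlinarith [hs.2]
  have hQsub : parabolicCylinder 1 (0 : ℝ × EuclideanSpace ℝ (Fin 3)) ⊆
      stAffine (c ^ 2 / ν) c tt x ⁻¹' (Ioo 0 T ×ˢ (univ : Set (EuclideanSpace ℝ (Fin 3)))) := by
    intro q hq
    simp only [parabolicCylinder, mem_prod, mem_Ioo, mem_ball, dist_zero_right, Prod.fst_zero,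
      Prod.snd_zero, zero_sub, one_pow] at hq
    obtain ⟨⟨hq1, hq2⟩, -⟩ := hq
    show stAffine (c ^ 2 / ν) c tt x q ∈ Ioo 0 T ×ˢ (univ : Set (EuclideanSpace ℝ (Fin 3)))
    rw [show q = (q.1, q.2) from rfl, stAffine_apply]
    obtain ⟨h1, h2⟩ := htime q.1 ⟨hq1, hq2⟩
    exact ⟨⟨by linarith, by linarith⟩, mem_univ _⟩
  have hwcl : IsClassicalNSSolutionOnRegion (parabolicCylinder 1 (0 : ℝ × EuclideanSpace ℝ (Fin 3))) 1 0 w π :=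
    hresc.mono_of_isOpen hQsub (isOpen_parabolicCylinder 1 0)
  -- the zoom is bounded by `M`
  have hwbd : ∀ q ∈ parabolicCylinder 1 (0 : ℝ × EuclideanSpace ℝ (Fin 3)), ‖w q.1 q.2‖ ≤ M := by
    intro q hq
    simp only [parabolicCylinder, mem_prod, mem_Ioo, mem_ball, dist_zero_right, Prod.fst_zero,
      Prod.snd_zero, zero_sub, one_pow] at hq
    obtain ⟨⟨hq1, hq2⟩, -⟩ := hq
    obtain ⟨h1, h2⟩ := htime q.1 ⟨hq1, hq2⟩
    have hs'I : tt + c ^ 2 / ν * q.1 ∈ Ico t₀ T := ⟨by linarith, by linarith⟩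
    have hTs' : (T - t) / 4 ≤ T - (tt + c ^ 2 / ν * q.1) := by linarith
    have hsq : Real.sqrt (T - t) / 2 ≤ Real.sqrt (T - (tt + c ^ 2 / ν * q.1)) := by
      have h4 : Real.sqrt (T - t) / 2 = Real.sqrt ((T - t) / 4) := by
        rw [Real.sqrt_div' _ (by norm_num : (0:ℝ) ≤ 4),
          show Real.sqrt 4 = 2 by rw [show (4:ℝ) = 2 ^ 2 by norm_num, Real.sqrt_sq (by norm_num)]]
      rw [h4]
      exact Real.sqrt_le_sqrt hTs'
    have hpos2 : 0 < Real.sqrt (T - t) / 2 := by positivity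
    have hT := hTI (tt + c ^ 2 / ν * q.1) hs'I (x + c • q.2)
    have hcν : 0 < c / ν := div_pos hc0 hν
    calc ‖w q.1 q.2‖ = c / ν * ‖u (tt + c ^ 2 / ν * q.1) (x + c • q.2)‖ := by
          rw [hw]
          simp only [Pi.smul_apply, stPull_apply, norm_smul, Real.norm_eq_abs, abs_of_pos hcν]
      _ ≤ c / ν * (M * Real.sqrt ν / Real.sqrt (T - (tt + c ^ 2 / ν * q.1))) :=
          mul_le_mul_of_nonneg_left hT hcν.le
      _ ≤ c / ν * (M * Real.sqrt ν / (Real.sqrt (T - t) / 2)) := by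
          refine mul_le_mul_of_nonneg_left ?_ hcν.le
          exact div_le_div_of_nonneg_left (by positivity) hpos2 hsq
      _ = M := by
          rw [hc]
          field_simp
          rw [Real.sq_sqrt hν.le]
  -- Serrin's bound at the interior point `(−1/2, 0)` of `Q(0, 3/4)`
  have hmem : (((-(1 / 2 : ℝ)), (0 : EuclideanSpace ℝ (Fin 3))) : ℝ × EuclideanSpace ℝ (Fin 3)) ∈
      parabolicCylinder (3 / 4) (0 : ℝ × EuclideanSpace ℝ (Fin 3)) := by
    refine ⟨⟨?_, ?_⟩, ?_⟩
    · show (0 : ℝ) - (3 / 4) ^ 2 < -(1 / 2); norm_num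
    · show (-(1 / 2) : ℝ) < 0; norm_num
    · show (0 : EuclideanSpace ℝ (Fin 3)) ∈ ball (0 : EuclideanSpace ℝ (Fin 3)) (3 / 4)
      exact mem_ball_self (by norm_num)
  have hwD : ‖iteratedFDeriv ℝ 2 (w (-(1 / 2))) 0‖ ≤ K :=
    hK w π hwcl hwbd ((-(1 / 2) : ℝ), (0 : EuclideanSpace ℝ (Fin 3))) hmem
  -- undo the zoom: `u t z = (ν/c) • w(−1/2)(c⁻¹ • (z − x))`
  have httop : tt + c ^ 2 / ν * (-(1 / 2)) = t := by rw [hcs, htt]; ring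
  obtain ⟨h, hh⟩ : ∃ h : EuclideanSpace ℝ (Fin 3) → EuclideanSpace ℝ (Fin 3),
      h = fun y => w (-(1 / 2)) (c⁻¹ • y) := ⟨_, rfl⟩
  obtain ⟨g, hg⟩ : ∃ g : EuclideanSpace ℝ (Fin 3) → EuclideanSpace ℝ (Fin 3),
      g = fun y => (ν / c) • h y := ⟨_, rfl⟩
  have hfun : u t = fun z => g (z - x) := by
    funext z
    rw [hg, hh, hw]
    simp only [Pi.smul_apply, stPull_apply, smul_smul]
    rw [httop, mul_inv_cancel₀ hc0.ne', one_smul, add_sub_cancel,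
      show ν / c * (c / ν) = 1 by field_simp, one_smul]
  -- smoothness of `h` at `0`
  have hhs : ContDiffAt ℝ 2 h (x - x) := by
    rw [sub_self, hh]
    have hmemQ : (((-(1 / 2 : ℝ)), (0 : EuclideanSpace ℝ (Fin 3))) : ℝ × EuclideanSpace ℝ (Fin 3)) ∈
        parabolicCylinder 1 (0 : ℝ × EuclideanSpace ℝ (Fin 3)) := by
      refine ⟨⟨?_, ?_⟩, ?_⟩
      · show (0 : ℝ) - 1 ^ 2 < -(1 / 2); norm_num
      · show (-(1 / 2) : ℝ) < 0; norm_num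
      · show (0 : EuclideanSpace ℝ (Fin 3)) ∈ ball (0 : EuclideanSpace ℝ (Fin 3)) 1
        exact mem_ball_self one_pos
    have h1 : ContDiffAt ℝ ∞ (uncurry w) (-(1 / 2), 0) :=
      hwcl.smooth_velocity.contDiffAt ((isOpen_parabolicCylinder 1 0).mem_nhds hmemQ)
    have h2 : ContDiffAt ℝ ∞ (w (-(1 / 2))) ((c⁻¹ : ℝ) • (0 : EuclideanSpace ℝ (Fin 3))) := by
      rw [smul_zero]
      exact h1.comp (0 : EuclideanSpace ℝ (Fin 3)) (contDiffAt_const.prodMk contDiffAt_id)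
    exact (h2.comp 0 (contDiffAt_id.const_smul c⁻¹)).of_le (by norm_cast)
  rw [hfun, iteratedFDeriv_comp_sub, hg, iteratedFDeriv_const_smul_apply' hhs, norm_smul, sub_self,
    Real.norm_eq_abs, abs_of_pos (div_pos hν hc0)]
  have h3 := Serrin.norm_iteratedFDeriv_comp_smul_le' (w (-(1 / 2))) (inv_ne_zero hc0.ne') 2
    (0 : EuclideanSpace ℝ (Fin 3))
  rw [smul_zero, abs_of_pos (inv_pos.2 hc0), ← hh] at h3
  have hc3 : Real.sqrt ν * (T - t) * Real.sqrt (T - t) = 8 * c ^ 3 / ν := by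
    rw [eq_div_iff hν.ne', hc]
    have ha : Real.sqrt ν ^ 2 = ν := Real.sq_sqrt hν.le
    have hb : Real.sqrt (T - t) ^ 2 = T - t := Real.sq_sqrt hTt.le
    calc Real.sqrt ν * (T - t) * Real.sqrt (T - t) * ν
        = Real.sqrt ν * Real.sqrt (T - t) ^ 2 * Real.sqrt (T - t) * Real.sqrt ν ^ 2 := by rw [ha, hb]
      _ = 8 * (Real.sqrt ν * Real.sqrt (T - t) / 2) ^ 3 := by ring
  calc ν / c * ‖iteratedFDeriv ℝ 2 h 0‖ ≤ ν / c * (c⁻¹ ^ 2 * K) :=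
        mul_le_mul_of_nonneg_left (h3.trans (mul_le_mul_of_nonneg_left hwD (by positivity)))
          (div_pos hν hc0).le
    _ = 8 * K / (8 * c ^ 3 / ν) := by field_simp
    _ = 8 * K / (Real.sqrt ν * (T - t) * Real.sqrt (T - t)) := by rw [hc3]

/-! ### The vorticity gradient and the parabolic-core Lipschitz bound (G) -/

/-- **Type-I ⇒ bounded vorticity gradient at the parabolic rate.** There is `K = K(M) ≥ 0` such that, in the
setting of `exists_norm_iteratedFDeriv_two_le_of_typeI`, `‖Dω(t,·)(y)‖ ≤ ‖curlCLM‖·8K/(√ν·(T−t)·√(T−t))` for all `y`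
(`ω = curl u(t)`; `‖D(curl v)‖ ≤ ‖curlCLM‖‖D²v‖`). -/
theorem exists_norm_fderiv_curl_le_of_typeI (M : ℝ) : ∃ K : ℝ, 0 ≤ K ∧
    ∀ (ν T t₀ : ℝ) (u : ℝ → EuclideanSpace ℝ (Fin 3) → EuclideanSpace ℝ (Fin 3))
      (p : ℝ → EuclideanSpace ℝ (Fin 3) → ℝ), 0 < ν →
      IsClassicalNSSolutionOn (Ico 0 T) ν 0 u p → 0 ≤ t₀ →
      (∀ s ∈ Ico t₀ T, ∀ y, ‖u s y‖ ≤ M * Real.sqrt ν / Real.sqrt (T - s)) →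
      ∀ t ∈ Ico t₀ T, t₀ ≤ t - (T - t) / 4 → ∀ y,
        ‖fderiv ℝ (curl (u t)) y‖ ≤ ‖curlCLM‖ * (8 * K) / (Real.sqrt ν * (T - t) * Real.sqrt (T - t)) := by
  obtain ⟨K, hK0, hK⟩ := exists_norm_iteratedFDeriv_two_le_of_typeI M
  refine ⟨K, hK0, fun ν T t₀ u p hν hsol ht₀ hTI t ht ht4 y => ?_⟩
  have hv : ContDiff ℝ ∞ (u t) := hsol.contDiff_velocity ⟨ht₀.trans ht.1, ht.2⟩
  have h2 := hK ν T t₀ u p hν hsol ht₀ hTI t ht ht4 y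
  have h1 : ‖fderiv ℝ (curl (u t)) y‖ = ‖iteratedFDeriv ℝ 1 (curl (u t)) y‖ := by
    rw [← norm_iteratedFDeriv_fderiv, norm_iteratedFDeriv_zero]
  rw [h1, mul_div_assoc]
  exact (norm_iteratedFDeriv_curl_le_opNorm_mul hv 1 (by exact_mod_cast le_top) y).trans
    (mul_le_mul_of_nonneg_left h2 (by positivity))

/-- **TYPE-I ⇒ (G)** (seed τ2; hypothesis (G) of door S36-C𝔞 `ArgmaxAnnulusDoor`). There is `K = K(M) ≥ 0` such
that: for every classical unforced solution on `[0,T) × ℝ³` (`ν > 0`) with the scale-invariant Type-I bound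
`‖u(s,y)‖ ≤ M√ν/√(T−s)` on `[t₀,T)`, every `t ∈ [t₀,T)` with `t₀ ≤ t − (T−t)/4`, every `ε > 0` and every point `x̄`
in the critical regime `ε < (T−t)‖ω(x̄,t)‖`:
`‖ω(y,t) − ω(x̄,t)‖ ≤ (8‖curlCLM‖K/ε)·‖ω(x̄,t)‖/√(ν(T−t))·‖y − x̄‖` for ALL `y` (mean value inequality; the core
Lipschitz bound (G) with `Γ = 8‖curlCLM‖K/ε`, valid at every radius `θ`). -/
theorem typeI_core_lipschitz (M : ℝ) : ∃ K : ℝ, 0 ≤ K ∧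
    ∀ (ν T t₀ : ℝ) (u : ℝ → EuclideanSpace ℝ (Fin 3) → EuclideanSpace ℝ (Fin 3))
      (p : ℝ → EuclideanSpace ℝ (Fin 3) → ℝ), 0 < ν →
      IsClassicalNSSolutionOn (Ico 0 T) ν 0 u p → 0 ≤ t₀ →
      (∀ s ∈ Ico t₀ T, ∀ y, ‖u s y‖ ≤ M * Real.sqrt ν / Real.sqrt (T - s)) →
      ∀ t ∈ Ico t₀ T, t₀ ≤ t - (T - t) / 4 → ∀ (ε : ℝ) (x : EuclideanSpace ℝ (Fin 3)), 0 < ε →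
        ε < (T - t) * ‖curl (u t) x‖ → ∀ y,
        ‖curl (u t) y - curl (u t) x‖ ≤
          ‖curlCLM‖ * (8 * K) / ε * ‖curl (u t) x‖ / Real.sqrt (ν * (T - t)) * ‖y - x‖ := by
  obtain ⟨K, hK0, hK⟩ := exists_norm_fderiv_curl_le_of_typeI M
  refine ⟨K, hK0, fun ν T t₀ u p hν hsol ht₀ hTI t ht ht4 ε x hε hcrit y => ?_⟩
  have hTt : 0 < T - t := sub_pos.2 ht.2
  have hsν : 0 < Real.sqrt ν := Real.sqrt_pos.2 hν
  have hsT : 0 < Real.sqrt (T - t) := Real.sqrt_pos.2 hTt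
  have hv : ContDiff ℝ ∞ (u t) := hsol.contDiff_velocity ⟨ht₀.trans ht.1, ht.2⟩
  have hω1 : ContDiff ℝ 1 (curl (u t)) := contDiff_curl (n := 1) (hv.of_le (by norm_cast))
  -- the global Lipschitz constant of `ω(t)`
  have hL := hK ν T t₀ u p hν hsol ht₀ hTI t ht ht4
  have hmv : ‖curl (u t) y - curl (u t) x‖ ≤
      ‖curlCLM‖ * (8 * K) / (Real.sqrt ν * (T - t) * Real.sqrt (T - t)) * ‖y - x‖ :=
    (convex_univ).norm_image_sub_le_of_norm_fderiv_le
      (fun z _ => (hω1.differentiable one_ne_zero).differentiableAt) (fun z _ => hL z)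
      (mem_univ x) (mem_univ y)
  refine hmv.trans (mul_le_mul_of_nonneg_right ?_ (norm_nonneg _))
  -- `1/(T−t) ≤ ‖ω(x̄)‖/ε` in the critical regime
  have hκK : 0 ≤ ‖curlCLM‖ * (8 * K) := by positivity
  have key : 1 / (T - t) ≤ ‖curl (u t) x‖ / ε := by
    rw [div_le_div_iff₀ hTt hε]
    nlinarith [hcrit]
  rw [Real.sqrt_mul hν.le]
  calc ‖curlCLM‖ * (8 * K) / (Real.sqrt ν * (T - t) * Real.sqrt (T - t))
      = ‖curlCLM‖ * (8 * K) / (Real.sqrt ν * Real.sqrt (T - t)) * (1 / (T - t)) := by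
        field_simp
    _ ≤ ‖curlCLM‖ * (8 * K) / (Real.sqrt ν * Real.sqrt (T - t)) * (‖curl (u t) x‖ / ε) :=
        mul_le_mul_of_nonneg_left key (by positivity)
    _ = ‖curlCLM‖ * (8 * K) / ε * ‖curl (u t) x‖ / (Real.sqrt ν * Real.sqrt (T - t)) := by
        field_simp

end Summit.NavierStokesRegularity.NavierStokesRegularity.Theorems.ArgmaxDoors

end
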